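import Literature.NumberTheory.Transcendental.CalegariDimitrovTangL2Chi3Period
import Literature.NumberTheory.Transcendental.CalegariDimitrovTangL2Chi3Overconvergence
import Mathlib.Analysis.SpecificLimits.Normed
import Mathlib.Tactic
import HarnessLib

/-!
# Calegari–Dimitrov–Tang, Theorem 1 — the Beukers-type integrals `Iₙ` of the overconvergence
Remark (§11.1): `I₀ = L(2, χ₋₃)`, `0 < Iₙ ≤ L(2, χ₋₃)`, convergence of `Σ Iₙ xⁿ` on `|x| < 1`

Sibling of `CalegariDimitrovTangL2Chi3.lean` (named fact
`Literature.NumberTheory.Transcendental.calegariDimitrovTang_linearIndependent`, CDT 2024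
Thm. 1), of `…Overconvergence.lean` (the peak-rate inequalities) and of `…Period.lean`
(`∬_{[0,1]²} ds dt/(1+st+s²t²) = L2chi3`). CDT, §11.1, Remark after Prop. "functionsH"
(eqs. (Cintegral), (boundary singularity as a max), p. 102) explain the overconvergence of
`H = b(H_B − ½L(2,χ₋₃)H_A) + …` through
`L(2,χ₋₃)H_A(x) − 2H_B(x) = Σₙ xⁿ Iₙ`, `Iₙ := ∬_{[0,1]²} (9st(1−s³)(1−t³))ⁿ ds dt / (1+st+s²t²)^{2n+1}`,
together with `max_{[0,1]²} |9st(1−s³)(1−t³)/(1+st+s²t²)²| = 1`, "from which it follows that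
the integrals are all bounded by `1`" — whence `Σ Iₙ xⁿ` converges on the unit disc although
`H_A`, `H_B` themselves have radius `1/9`.

This file PROVES the analytic half of that remark for the integrals `Iₙ` (written out, no new
definition):

* `CalegariDimitrovTang.setIntegral_beukersIntegrand_zero` — `I₀ = L2chi3` (from `…Period.lean`);
* `CalegariDimitrovTang.beukersIntegrand_le_kernel`, `…_nonneg`, `…_pos` — on the closed square
  `0 ≤ (9st(1−s³)(1−t³))ⁿ/(1+st+s²t²)^{2n+1} ≤ 1/(1+st+s²t²)`, with `> 0` on the open square;
* `CalegariDimitrovTang.setIntegral_beukersIntegrand_pos`, `…_le_L2chi3`, `…_le_one` —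
  `0 < Iₙ ≤ L(2,χ₋₃) ≤ 1` for every `n` ("the integrals are all bounded by `1`");
* `CalegariDimitrovTang.summable_setIntegral_beukersIntegrand_mul_pow` — for real `|x| < 1` the
  series `Σₙ Iₙ xⁿ` converges (comparison with the geometric series).

Not here: the identity (Cintegral) `Iₙ = L(2,χ₋₃)aₙ − 2bₙ` itself for `n ≥ 1` (a two-dimensional
creative-telescoping computation, "by hand using a little effort or by [AZ]"), which is what ties
these integrals to Zagier's sequences of `…Proofs.lean`. No named facts (D-0026).

## References

* [CalegariDimitrovTang2024] arXiv:2408.15403, §11.1, Remark after Prop. "functionsH",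
  eqs. (Cintegral), (boundary singularity as a max) (p. 102).
-/

noncomputable section

open MeasureTheory Set Filter Real

namespace Literature.NumberTheory.Transcendental

namespace CalegariDimitrovTang

/-! ### The integrand `(9st(1−s³)(1−t³))ⁿ / (1+st+s²t²)^{2n+1}` -/

/-- The denominator `1 + st + s²t²` is positive everywhere. [folklore] -/
theorem beukersDen_pos (p : ℝ × ℝ) : 0 < 1 + p.1 * p.2 + p.1 ^ 2 * p.2 ^ 2 := by
  have := kernel_den_pos (p.1 * p.2)
  rw [mul_pow] at this
  exact this

/-- The Beukers-type integrand of (Cintegral) is continuous on `ℝ²`. [folklore] -/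
theorem continuous_beukersIntegrand (n : ℕ) :
    Continuous fun p : ℝ × ℝ =>
      (9 * p.1 * p.2 * (1 - p.1 ^ 3) * (1 - p.2 ^ 3)) ^ n
        / (1 + p.1 * p.2 + p.1 ^ 2 * p.2 ^ 2) ^ (2 * n + 1) :=
  Continuous.div (by fun_prop) (by fun_prop) fun p => pow_ne_zero _ (beukersDen_pos p).ne'

/-- … hence integrable on the unit square. [folklore] -/
theorem integrableOn_beukersIntegrand (n : ℕ) :
    IntegrableOn (fun p : ℝ × ℝ =>
      (9 * p.1 * p.2 * (1 - p.1 ^ 3) * (1 - p.2 ^ 3)) ^ n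
        / (1 + p.1 * p.2 + p.1 ^ 2 * p.2 ^ 2) ^ (2 * n + 1))
      (Icc (0 : ℝ) 1 ×ˢ Icc (0 : ℝ) 1) volume :=
  ContinuousOn.integrableOn_compact isCompact_unitSquare (continuous_beukersIntegrand n).continuousOn

/-- On the closed unit square the numerator `9st(1−s³)(1−t³)` is nonnegative. [folklore] -/
theorem beukersNum_nonneg {p : ℝ × ℝ} (hp : p ∈ Icc (0 : ℝ) 1 ×ˢ Icc (0 : ℝ) 1) :
    0 ≤ 9 * p.1 * p.2 * (1 - p.1 ^ 3) * (1 - p.2 ^ 3) := by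
  obtain ⟨⟨h10, h11⟩, ⟨h20, h21⟩⟩ := hp
  have h13 : p.1 ^ 3 ≤ 1 := pow_le_one₀ h10 h11
  have h23 : p.2 ^ 3 ≤ 1 := pow_le_one₀ h20 h21
  have : 0 ≤ 1 - p.1 ^ 3 := by linarith
  have : 0 ≤ 1 - p.2 ^ 3 := by linarith
  positivity

/-- On the closed unit square the integrand is nonnegative. [folklore] -/
theorem beukersIntegrand_nonneg {p : ℝ × ℝ} (hp : p ∈ Icc (0 : ℝ) 1 ×ˢ Icc (0 : ℝ) 1) (n : ℕ) :
    0 ≤ (9 * p.1 * p.2 * (1 - p.1 ^ 3) * (1 - p.2 ^ 3)) ^ n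
        / (1 + p.1 * p.2 + p.1 ^ 2 * p.2 ^ 2) ^ (2 * n + 1) :=
  div_nonneg (pow_nonneg (beukersNum_nonneg hp) n) (pow_nonneg (beukersDen_pos p).le _)

/-- **The peak-rate bound, integrand form**: on the closed unit square
`(9st(1−s³)(1−t³))ⁿ/(1+st+s²t²)^{2n+1} ≤ 1/(1+st+s²t²)`, because
`9st(1−s³)(1−t³) ≤ (1+st+s²t²)²` (`peakRate_chi3_le`, CDT eq. (boundary singularity as a max)).
[cite: CalegariDimitrovTang2024, §11.1 eq. (boundary singularity as a max) (p. 102)] -/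
theorem beukersIntegrand_le_kernel {p : ℝ × ℝ} (hp : p ∈ Icc (0 : ℝ) 1 ×ˢ Icc (0 : ℝ) 1)
    (n : ℕ) :
    (9 * p.1 * p.2 * (1 - p.1 ^ 3) * (1 - p.2 ^ 3)) ^ n
        / (1 + p.1 * p.2 + p.1 ^ 2 * p.2 ^ 2) ^ (2 * n + 1)
      ≤ 1 / (1 + p.1 * p.2 + p.1 ^ 2 * p.2 ^ 2) := by
  have hD := beukersDen_pos p
  have hle : 9 * p.1 * p.2 * (1 - p.1 ^ 3) * (1 - p.2 ^ 3)
      ≤ (1 + p.1 * p.2 + p.1 ^ 2 * p.2 ^ 2) ^ 2 := peakRate_chi3_le hp.1 hp.2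
  have hpow : (9 * p.1 * p.2 * (1 - p.1 ^ 3) * (1 - p.2 ^ 3)) ^ n
      ≤ (1 + p.1 * p.2 + p.1 ^ 2 * p.2 ^ 2) ^ (2 * n) := by
    rw [pow_mul]
    exact pow_le_pow_left₀ (beukersNum_nonneg hp) hle n
  calc (9 * p.1 * p.2 * (1 - p.1 ^ 3) * (1 - p.2 ^ 3)) ^ n
        / (1 + p.1 * p.2 + p.1 ^ 2 * p.2 ^ 2) ^ (2 * n + 1)
      ≤ (1 + p.1 * p.2 + p.1 ^ 2 * p.2 ^ 2) ^ (2 * n)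
          / (1 + p.1 * p.2 + p.1 ^ 2 * p.2 ^ 2) ^ (2 * n + 1) :=
        div_le_div_of_nonneg_right hpow (pow_nonneg hD.le _)
    _ = 1 / (1 + p.1 * p.2 + p.1 ^ 2 * p.2 ^ 2) := by
        rw [pow_succ (1 + p.1 * p.2 + p.1 ^ 2 * p.2 ^ 2) (2 * n), ← div_div,
          div_self (pow_ne_zero _ hD.ne'), one_div]

/-- On the open unit square the integrand is positive. [folklore] -/
theorem beukersIntegrand_pos {p : ℝ × ℝ} (hp : p ∈ Ioo (0 : ℝ) 1 ×ˢ Ioo (0 : ℝ) 1) (n : ℕ) :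
    0 < (9 * p.1 * p.2 * (1 - p.1 ^ 3) * (1 - p.2 ^ 3)) ^ n
        / (1 + p.1 * p.2 + p.1 ^ 2 * p.2 ^ 2) ^ (2 * n + 1) := by
  obtain ⟨⟨h10, h11⟩, ⟨h20, h21⟩⟩ := hp
  have h13 : p.1 ^ 3 < 1 := pow_lt_one₀ h10.le h11 three_ne_zero
  have h23 : p.2 ^ 3 < 1 := pow_lt_one₀ h20.le h21 three_ne_zero
  have : 0 < 1 - p.1 ^ 3 := by linarith
  have : 0 < 1 - p.2 ^ 3 := by linarith
  have hN : 0 < 9 * p.1 * p.2 * (1 - p.1 ^ 3) * (1 - p.2 ^ 3) := by positivity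
  exact div_pos (pow_pos hN n) (pow_pos (beukersDen_pos p) _)

/-! ### The integrals `Iₙ` -/

/-- **`I₀ = L(2, χ₋₃)`**: the `n = 0` integral is `∬_{[0,1]²} ds dt/(1+st+s²t²) = L2chi3`
(`setIntegral_unitSquare_kernel`). [cite: CalegariDimitrovTang2024, §11.1 eq. (Cintegral), n = 0 (p. 102)] -/
theorem setIntegral_beukersIntegrand_zero :
    ∫ p in Icc (0 : ℝ) 1 ×ˢ Icc (0 : ℝ) 1,
        (9 * p.1 * p.2 * (1 - p.1 ^ 3) * (1 - p.2 ^ 3)) ^ 0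
          / (1 + p.1 * p.2 + p.1 ^ 2 * p.2 ^ 2) ^ (2 * 0 + 1) = L2chi3 := by
  simp only [pow_zero, mul_zero, zero_add, pow_one]
  exact setIntegral_unitSquare_kernel

/-- **`Iₙ ≤ L(2, χ₋₃)`** for every `n` (integrate `beukersIntegrand_le_kernel`).
[cite: CalegariDimitrovTang2024, §11.1, Remark after Prop. "functionsH" (p. 102)] -/
theorem setIntegral_beukersIntegrand_le_L2chi3 (n : ℕ) :
    ∫ p in Icc (0 : ℝ) 1 ×ˢ Icc (0 : ℝ) 1,
        (9 * p.1 * p.2 * (1 - p.1 ^ 3) * (1 - p.2 ^ 3)) ^ n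
          / (1 + p.1 * p.2 + p.1 ^ 2 * p.2 ^ 2) ^ (2 * n + 1) ≤ L2chi3 := by
  rw [← setIntegral_unitSquare_kernel]
  refine setIntegral_mono_on (integrableOn_beukersIntegrand n) ?_ measurableSet_unitSquare
    fun p hp => beukersIntegrand_le_kernel hp n
  exact ContinuousOn.integrableOn_compact isCompact_unitSquare
    (continuous_beukersIntegrand 0 |>.continuousOn.congr fun p _ => by simp)

/-- **"The integrals are all bounded by `1`"**: `Iₙ ≤ 1` (indeed `≤ L(2,χ₋₃) = 0.78…`; here from
`L2chi3 ≤ Σ 1/(3n+1)² ≤ …` we only need the cruder `Iₙ ≤ ∬ 1 = 1`, obtained from the pointwise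
bound `≤ 1` of `…Overconvergence.lean`). [cite: CalegariDimitrovTang2024, §11.1, Remark after Prop. "functionsH" (p. 102)] -/
theorem setIntegral_beukersIntegrand_le_one (n : ℕ) :
    ∫ p in Icc (0 : ℝ) 1 ×ˢ Icc (0 : ℝ) 1,
        (9 * p.1 * p.2 * (1 - p.1 ^ 3) * (1 - p.2 ^ 3)) ^ n
          / (1 + p.1 * p.2 + p.1 ^ 2 * p.2 ^ 2) ^ (2 * n + 1) ≤ 1 := by
  have hvol : (volume (Icc (0 : ℝ) 1 ×ˢ Icc (0 : ℝ) 1)).toReal = 1 := by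
    rw [Measure.volume_eq_prod, Measure.prod_prod, Real.volume_Icc]
    simp
  calc ∫ p in Icc (0 : ℝ) 1 ×ˢ Icc (0 : ℝ) 1,
        (9 * p.1 * p.2 * (1 - p.1 ^ 3) * (1 - p.2 ^ 3)) ^ n
          / (1 + p.1 * p.2 + p.1 ^ 2 * p.2 ^ 2) ^ (2 * n + 1)
      ≤ ∫ p in Icc (0 : ℝ) 1 ×ˢ Icc (0 : ℝ) 1, (1 : ℝ) := by
        refine setIntegral_mono_on (integrableOn_beukersIntegrand n) ?_ measurableSet_unitSquare
          fun p hp => beukersKernel_chi3_pow_le_one hp.1 hp.2 n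
        exact (integrableOn_const_iff (C := (1 : ℝ))).mpr (Or.inr (by
          rw [Measure.volume_eq_prod, Measure.prod_prod, Real.volume_Icc]; simp))
    _ = 1 := by rw [setIntegral_const, smul_eq_mul, mul_one, measureReal_def, hvol]

/-- The open unit square has Lebesgue measure `1` (in particular it is not null). [folklore] -/
theorem volume_Ioo_prod_Ioo : volume (Ioo (0 : ℝ) 1 ×ˢ Ioo (0 : ℝ) 1) = 1 := by
  rw [Measure.volume_eq_prod, Measure.prod_prod, Real.volume_Ioo]
  simp

/-- **`Iₙ > 0`**: the integrand is nonnegative on the closed square and positive on the open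
square, which has positive measure. [folklore] -/
theorem setIntegral_beukersIntegrand_pos (n : ℕ) :
    0 < ∫ p in Icc (0 : ℝ) 1 ×ˢ Icc (0 : ℝ) 1,
        (9 * p.1 * p.2 * (1 - p.1 ^ 3) * (1 - p.2 ^ 3)) ^ n
          / (1 + p.1 * p.2 + p.1 ^ 2 * p.2 ^ 2) ^ (2 * n + 1) := by
  have hnn : 0 ≤ᵐ[volume.restrict (Icc (0 : ℝ) 1 ×ˢ Icc (0 : ℝ) 1)] fun p : ℝ × ℝ =>
      (9 * p.1 * p.2 * (1 - p.1 ^ 3) * (1 - p.2 ^ 3)) ^ n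
        / (1 + p.1 * p.2 + p.1 ^ 2 * p.2 ^ 2) ^ (2 * n + 1) :=
    ae_restrict_of_forall_mem measurableSet_unitSquare fun p hp => beukersIntegrand_nonneg hp n
  rw [setIntegral_pos_iff_support_of_nonneg_ae hnn (integrableOn_beukersIntegrand n)]
  have hsub : (Ioo (0 : ℝ) 1 ×ˢ Ioo (0 : ℝ) 1 : Set (ℝ × ℝ)) ⊆
      Function.support (fun p : ℝ × ℝ =>
        (9 * p.1 * p.2 * (1 - p.1 ^ 3) * (1 - p.2 ^ 3)) ^ n
          / (1 + p.1 * p.2 + p.1 ^ 2 * p.2 ^ 2) ^ (2 * n + 1)) ∩ (Icc (0 : ℝ) 1 ×ˢ Icc (0 : ℝ) 1) := by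
    intro p hp
    refine ⟨?_, ⟨Ioo_subset_Icc_self hp.1, Ioo_subset_Icc_self hp.2⟩⟩
    rw [Function.mem_support]
    exact (beukersIntegrand_pos hp n).ne'
  calc (0 : ENNReal) < 1 := one_pos
    _ = volume (Ioo (0 : ℝ) 1 ×ˢ Ioo (0 : ℝ) 1) := volume_Ioo_prod_Ioo.symm
    _ ≤ _ := measure_mono hsub

/-! ### Convergence of `Σ Iₙ xⁿ` on the unit disc -/

/-- **Unit-disc convergence**: for real `|x| < 1` the series `Σₙ Iₙ xⁿ` converges absolutely
(`0 < Iₙ ≤ 1` and the geometric series) — the mechanism by which CDT's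
`L(2,χ₋₃)H_A(x) − 2H_B(x) = Σ Iₙ xⁿ` overconverges from radius `1/9` to radius `1`.
[cite: CalegariDimitrovTang2024, §11.1, Remark after Prop. "functionsH" (p. 102)] -/
theorem summable_setIntegral_beukersIntegrand_mul_pow {x : ℝ} (hx : |x| < 1) :
    Summable fun n : ℕ =>
      (∫ p in Icc (0 : ℝ) 1 ×ˢ Icc (0 : ℝ) 1,
        (9 * p.1 * p.2 * (1 - p.1 ^ 3) * (1 - p.2 ^ 3)) ^ n
          / (1 + p.1 * p.2 + p.1 ^ 2 * p.2 ^ 2) ^ (2 * n + 1)) * x ^ n := by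
  refine Summable.of_norm_bounded (summable_geometric_of_lt_one (abs_nonneg x) hx) fun n => ?_
  rw [Real.norm_eq_abs, abs_mul, abs_pow,
    abs_of_pos (setIntegral_beukersIntegrand_pos n)]
  exact mul_le_of_le_one_left (pow_nonneg (abs_nonneg x) n)
    (setIntegral_beukersIntegrand_le_one n)

end CalegariDimitrovTang

end Literature.NumberTheory.Transcendental
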